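import Summits.CriticalPhenomena.PercolationContinuityZ3.Theorems.PercNearOneGluingNoHeavyConstsClusterSquareApicesQuadLinked
import Summits.CriticalPhenomena.PercolationContinuityZ3.Theorems.PercNearOneGluingNoHeavyConstsClusterSquareQuadClash
import Summits.CriticalPhenomena.PercolationContinuityZ3.Theorems.PercNearOneGluingNoHeavyConstsClusterSquareApicesBadRoot
import Summits.CriticalPhenomena.PercolationContinuityZ3.Theorems.PercNearOneGluingNoHeavyConstsClusterSquareApicesSectors
import HarnessLib

/-!
# Outerplanar graph plus independent apices: CSQ/DUU at an APEX root under the sector condition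

builds on p205010 (kernel theorem, internal audit signed; external expert review pending)

PAPER-2 track "percolation constants", part (ii), seat `prim-consts-1`, gen 22 (lane index
`run/shared/lean/prim/consts/CONSTANTS.md`, row A19; memo `FROM-prim-consts-1-g22-CROSS-LINKAGE.md` §2).
Support file for the crux `NoHeavyLowerTail` (stmt-CriticalPhenomena-4575; `--supports`).  Theorems only; no definitions, no sorries.

THE CLASS (gen 20, `…ConstsClusterSquareApices.lean`): `H` on `Fin n`, a predicate `hub` (the apices), rim positions `pos`,
hypotheses (I)(R)(F)(L)(L2).  `…ConstsClusterSquareApicesQuad.lean`: no quadruple clash at a RIM root.  HERE the root is an APEX `h`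
and the terminals `b, c` are arbitrary.  A terminal is REPRESENTED by itself (rim) or by its rim neighbours (apex).  SECTOR CONDITION
at `(h; b, c)`: no chord `{α, β}` of `h` strictly separates a representative of `b` from a representative of `c` (cut open at `α`:
one strictly before `β`, the other strictly after).  For one apex and rim terminals this is the condition (S) of
`…ConstsClusterSquareApexHub.lean`.
* `Consts.Apices.nqc_apexRoot`: under the sector condition no quadruple clash occurs at `(h; b, c)`: a quadruple clash lives on the
  cluster `K = C_h(ω)`; if `K` contains a rim vertex it is a cross-linkage at a rim-rooted cluster (`Consts.Apices.false_of_quad`);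
  else `K = {h}` carries bad root data and `Consts.Apices.sep_of_badRoot` contradicts the sector condition.
* **`Consts.clusterSquare_le_sq_of_apices_apex`, `Consts.sq_real_split_le_of_apices_apex`, `Consts.tripleSplit_of_apices_apex`**:
  CSQ, DUU and TS at an apex root under the sector condition, for every weight vector supported on `H`.
`…ConstsClusterSquareApicesAllTriples.lean` removes the condition for TS: of three apices at most one violates it
(`Consts.Apices.not_sep_sep`), so TS holds for EVERY triple of terminals of the class.
The sector condition is needed for CSQ/DUU at an apex root: `W₄` rooted at the hub with the two other terminals antipodal carries a
quadruple clash (gen 18's exact reach of the two-copy method); lane census g22 `eng/apexroot.py`: quadruple clashes at apex roots for all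
terminal types (three apices, 4 rim vertices: 42 / 264 / 174 rooted instances with 2 / 1 / 0 apex terminals among 19 840 graphs).
References: N. Gladkov, arXiv:2408.08457v2 (2024), Def. 4.2, Thm. 4.3, Lemma 3.1, Ex. 2.5, Thm. 5.2, Cor. 5.3; J. van den Berg,
O. Häggström, J. Kahn, Random Structures Algorithms 29 (2006), §1; G. Chartrand, F. Harary, Ann. Inst. H. Poincaré B 3 (1967) 433–438.
-/

noncomputable section

open Classical

namespace Summit.CriticalPhenomena.PercolationContinuityZ3.Theorems

open MeasureTheory Finset Literature.Probability.LatticeModels Literature.Probability.Percolation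
open Literature.Probability.Percolation.DecisionTree Literature.Probability.Percolation.BHK2006
open Literature.Probability.Percolation.TargetExploration Literature.Probability.Percolation.ClusterConditioning

namespace Consts

namespace Apices

variable {n m : ℕ}

/-- **NO QUADRUPLE CLASH AT AN APEX ROOT UNDER THE SECTOR CONDITION** (class (I)(R)(F)(L)(L2); root = apex `h`; terminals `b, c`
arbitrary; sector condition `hS`: no chord of `h` strictly separates a representative of `b` from a representative of `c`): the
hypothesis of `Consts.clusterSquare_le_sq_of_noQuadClash_pos w h b c` holds.  A quadruple clash lives on `K = C_h(ω)`: a rim vertex in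
`K` makes it a cross-linkage at a rim-rooted cluster (`Consts.Apices.false_of_quad`); otherwise `K = {h}` and the clash is bad root
data, which separate the terminals (`Consts.Apices.sep_of_badRoot`, `…ApicesBadRoot.lean`; the graphs come from
`Consts.Apices.exists_graphs`, `…ApicesSectors.lean`). [folklore: Jordan curve theorem; input for Gladkov2024, Thm. 4.3] -/
theorem nqc_apexRoot (H : SimpleGraph (Fin n)) (hub : Fin n → Prop) (pos : Fin n → Fin m) (w : Sym2 (Fin n) → unitInterval)
    (hH : ∀ u v, u ≠ v → (0 : ℝ) < w s(u, v) → H.Adj u v)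
    (hpos : ∀ u v, ¬ hub u → ¬ hub v → pos u = pos v → u = v)
    (hI : ∀ u v, hub u → hub v → ¬ H.Adj u v)
    (hR : ∀ p q r s : Fin n, ¬ hub p → ¬ hub q → ¬ hub r → ¬ hub s → H.Adj p q → H.Adj r s →
      pos p < pos r → pos r < pos q → pos q < pos s → False)
    (hF : ∀ x p q u v : Fin n, hub x → ¬ hub p → ¬ hub q → H.Adj p q → H.Adj x u → H.Adj x v →
      pos p < pos u → pos u < pos q → (pos q < pos v ∨ pos v < pos p) → False)
    (hL : ∀ x x' u v u' v' : Fin n, hub x → hub x' → x ≠ x' → H.Adj x u → H.Adj x v → H.Adj x' u' → H.Adj x' v' →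
      pos u < pos u' → pos u' < pos v → pos v < pos v' → False)
    (hL2 : ∀ x x' u v t : Fin n, hub x → hub x' → x ≠ x' → u ≠ v → u ≠ t → v ≠ t →
      H.Adj x u → H.Adj x v → H.Adj x t → H.Adj x' u → H.Adj x' v → H.Adj x' t → False)
    {h b c : Fin n} (hh : hub h)
    (hS : ∀ α β t t' : Fin n, H.Adj h α → H.Adj h β → ¬ hub t → ¬ hub t' →
      ((¬ hub b ∧ t = b) ∨ (hub b ∧ H.Adj b t)) → ((¬ hub c ∧ t' = c) ∨ (hub c ∧ H.Adj c t')) →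
      ¬ ((0 < (pos t - pos α).val ∧ (pos t - pos α).val < (pos β - pos α).val ∧ (pos β - pos α).val < (pos t' - pos α).val) ∨
        (0 < (pos t' - pos α).val ∧ (pos t' - pos α).val < (pos β - pos α).val ∧
          (pos β - pos α).val < (pos t - pos α).val))) :
    ∀ ω η : BondConfig (Fin n), (∀ e ∈ ω, (0 : ℝ) < w e) → (∀ e ∈ η, (0 : ℝ) < w e) →
      ¬ (openGraph ω).Reachable h b → ¬ (openGraph ω).Reachable h c →
      ¬ (openGraph ω).Reachable b c → ¬ (openGraph (η \ barOf {h} (setCl ω {h}))).Reachable b c →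
      ¬ ((∃ y k : Fin n, (openGraph ω).Reachable h k ∧ (0 : ℝ) < w s(k, y) ∧ (openGraph ω).Reachable b y ∧
            (openGraph (η \ barOf {h} (setCl ω {h}))).Reachable c y) ∧
         (∃ y k : Fin n, (openGraph ω).Reachable h k ∧ (0 : ℝ) < w s(k, y) ∧ (openGraph ω).Reachable c y ∧
            (openGraph (η \ barOf {h} (setCl ω {h}))).Reachable b y) ∧
         (∃ y k : Fin n, (openGraph ω).Reachable h k ∧ (0 : ℝ) < w s(k, y) ∧ (openGraph ω).Reachable b y ∧
            (openGraph (η \ barOf {h} (setCl ω {h}))).Reachable b y) ∧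
         (∃ y k : Fin n, (openGraph ω).Reachable h k ∧ (0 : ℝ) < w s(k, y) ∧ (openGraph ω).Reachable c y ∧
            (openGraph (η \ barOf {h} (setCl ω {h}))).Reachable c y)) := by
  obtain ⟨G₀, Hp, C, g1, g2, g3, c1, hx⟩ := exists_graphs H hub pos hR hF hL
  intro ω η hω hη hab hac hbc hbc'
  rintro ⟨⟨y, k, hk, hw, hby, hcy⟩, ⟨y', k', hk', hw', hcy', hby'⟩, ⟨z, k₃, hk₃, hw₃, hbz, hbz'⟩, ⟨z', k₄, hk₄, hw₄, hcz, hcz'⟩⟩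
  set θ := η \ barOf {h} (setCl ω {h}) with hθdef
  set K : Set (Fin n) := {x | (openGraph ω).Reachable h x} with hKdef
  have hadjH : ∀ (ξ : Set (Sym2 (Fin n))), (∀ e ∈ ξ, (0 : ℝ) < w e) → openGraph ξ ≤ H := by
    intro ξ hξ u v huv
    rw [openGraph_adj] at huv
    exact hH u v huv.2 (hξ _ huv.1)
  have hθ : ∀ e ∈ θ, (0 : ℝ) < w e := fun e he => hη e he.1
  have hθK : ∀ u v, (openGraph θ).Adj u v → ¬ (openGraph ω).Reachable h v := by
    intro u v huv hav
    rw [openGraph_adj, hθdef, barOf_setCl_singleton_eq_cutSet] at huv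
    exact huv.1.2 ⟨v, Sym2.mem_mk_right u v, hav⟩
  have hhK : h ∈ K := SimpleGraph.Reachable.refl h
  have hyK : y ∉ K := fun h => hab (h.trans hby.symm)
  have hy'K : y' ∉ K := fun h => hac (h.trans hcy'.symm)
  have hzK : z ∉ K := fun h => hab (h.trans hbz.symm)
  have hz'K : z' ∉ K := fun h => hac (h.trans hcz.symm)
  have hky : H.Adj k y := hH k y (fun h => hyK (h ▸ hk)) hw
  have hky' : H.Adj k' y' := hH k' y' (fun h => hy'K (h ▸ hk')) hw'
  have hk₃z : H.Adj k₃ z := hH k₃ z (fun h => hzK (h ▸ hk₃)) hw₃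
  have hk₄z' : H.Adj k₄ z' := hH k₄ z' (fun h => hz'K (h ▸ hk₄)) hw₄
  -- distinctness of the clash vertices
  have hyy' : y ≠ y' := fun h => hbc (hby.trans (by rw [h]; exact hcy'.symm))
  have hyz : y ≠ z := fun h => hbc' (hbz'.trans (by rw [← h]; exact hcy.symm))
  have hyz' : y ≠ z' := fun h => hbc (hby.trans (by rw [h]; exact hcz.symm))
  have hy'z : y' ≠ z := fun h => hbc (hbz.trans (by rw [← h]; exact hcy'.symm))
  have hy'z' : y' ≠ z' := fun h => hbc' (hby'.trans (by rw [h]; exact hcz'.symm))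
  have hzz' : z ≠ z' := fun h => hbc (hbz.trans (by rw [h]; exact hcz.symm))
  -- the walks through the terminals: `y → b → z`, `y' → c → z'` (ω) and `y' → b → z`, `y → c → z'` (θ)
  obtain ⟨P₁⟩ := hby.symm; obtain ⟨W₁⟩ := hbz.symm
  obtain ⟨P₂⟩ := hcy'.symm; obtain ⟨W₁'⟩ := hcz.symm
  obtain ⟨Q₂⟩ := hby'.symm; obtain ⟨W₂⟩ := hbz'.symm
  obtain ⟨Q₁⟩ := hcy.symm; obtain ⟨W₂'⟩ := hcz'.symm
  let R₁ := (P₁.append W₁.reverse).mapLe (hadjH ω hω)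
  let R₂ := (P₂.append W₁'.reverse).mapLe (hadjH ω hω)
  let R₃ := (Q₂.append W₂.reverse).mapLe (hadjH θ hθ)
  let R₄ := (Q₁.append W₂'.reverse).mapLe (hadjH θ hθ)
  have mR₁ : ∀ x, x ∈ R₁.support ↔ x ∈ P₁.support ∨ x ∈ W₁.support := fun x => by
    simp only [R₁, SimpleGraph.Walk.support_mapLe_eq_support, SimpleGraph.Walk.mem_support_append_iff,
      SimpleGraph.Walk.support_reverse, List.mem_reverse]
  have mR₂ : ∀ x, x ∈ R₂.support ↔ x ∈ P₂.support ∨ x ∈ W₁'.support := fun x => by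
    simp only [R₂, SimpleGraph.Walk.support_mapLe_eq_support, SimpleGraph.Walk.mem_support_append_iff,
      SimpleGraph.Walk.support_reverse, List.mem_reverse]
  have mR₃ : ∀ x, x ∈ R₃.support ↔ x ∈ Q₂.support ∨ x ∈ W₂.support := fun x => by
    simp only [R₃, SimpleGraph.Walk.support_mapLe_eq_support, SimpleGraph.Walk.mem_support_append_iff,
      SimpleGraph.Walk.support_reverse, List.mem_reverse]
  have mR₄ : ∀ x, x ∈ R₄.support ↔ x ∈ Q₁.support ∨ x ∈ W₂'.support := fun x => by
    simp only [R₄, SimpleGraph.Walk.support_mapLe_eq_support, SimpleGraph.Walk.mem_support_append_iff,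
      SimpleGraph.Walk.support_reverse, List.mem_reverse]
  have hR₁b : ∀ x ∈ R₁.support, (openGraph ω).Reachable b x := fun x hx => by
    rcases (mR₁ x).1 hx with hx | hx
    · exact hby.trans ⟨P₁.takeUntil x hx⟩
    · exact hbz.trans ⟨W₁.takeUntil x hx⟩
  have hR₂c : ∀ x ∈ R₂.support, (openGraph ω).Reachable c x := fun x hx => by
    rcases (mR₂ x).1 hx with hx | hx
    · exact hcy'.trans ⟨P₂.takeUntil x hx⟩
    · exact hcz.trans ⟨W₁'.takeUntil x hx⟩
  have hR₃b : ∀ x ∈ R₃.support, (openGraph θ).Reachable b x := fun x hx => by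
    rcases (mR₃ x).1 hx with hx | hx
    · exact hby'.trans ⟨Q₂.takeUntil x hx⟩
    · exact hbz'.trans ⟨W₂.takeUntil x hx⟩
  have hR₄c : ∀ x ∈ R₄.support, (openGraph θ).Reachable c x := fun x hx => by
    rcases (mR₄ x).1 hx with hx | hx
    · exact hcy.trans ⟨Q₁.takeUntil x hx⟩
    · exact hcz'.trans ⟨W₂'.takeUntil x hx⟩
  have hR₁ : ∀ x ∈ R₁.support, x ∉ K := fun x hx hxK => hab (hxK.trans (hR₁b x hx).symm)
  have hR₂ : ∀ x ∈ R₂.support, x ∉ K := fun x hx hxK => hac (hxK.trans (hR₂c x hx).symm)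
  have hR₃ : ∀ x ∈ R₃.support, x ∉ K := fun x hx => by
    rcases (mR₃ x).1 hx with hx | hx
    · exact not_reachable_of_mem_support h hθK Q₂ hy'K x hx
    · exact not_reachable_of_mem_support h hθK W₂ hzK x hx
  have hR₄ : ∀ x ∈ R₄.support, x ∉ K := fun x hx => by
    rcases (mR₄ x).1 hx with hx | hx
    · exact not_reachable_of_mem_support h hθK Q₁ hyK x hx
    · exact not_reachable_of_mem_support h hθK W₂' hz'K x hx
  have hd₁₂ : ∀ x, x ∈ R₁.support → x ∉ R₂.support := fun x h1 h2 => hbc ((hR₁b x h1).trans (hR₂c x h2).symm)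
  have hd₃₄ : ∀ x, x ∈ R₃.support → x ∉ R₄.support := fun x h3 h4 => hbc' ((hR₃b x h3).trans (hR₄c x h4).symm)
  have hbR₁ : b ∈ R₁.support := (mR₁ b).2 (Or.inl P₁.end_mem_support)
  have hcR₂ : c ∈ R₂.support := (mR₂ c).2 (Or.inl P₂.end_mem_support)
  have hbR₃ : b ∈ R₃.support := (mR₃ b).2 (Or.inl Q₂.end_mem_support)
  have hcR₄ : c ∈ R₄.support := (mR₄ c).2 (Or.inl Q₁.end_mem_support)
  by_cases hrim : ∃ r, r ∈ K ∧ ¬ hub r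
  · -- CASE A: `K` contains a rim vertex `r`: a cross-linkage at a rim-rooted cluster
    obtain ⟨r, hrK, hr⟩ := hrim
    obtain ⟨x0, x0', xC, xC', xCC⟩ := hx r
    have hKw : ∀ s ∈ K, ∃ W : H.Walk r s, ∀ v ∈ W.support, v ∈ K := by
      intro s hs
      obtain ⟨X⟩ := hrK.symm.trans hs
      exact ⟨X.mapLe (hadjH ω hω), fun v hv => by
        rw [SimpleGraph.Walk.support_mapLe_eq_support] at hv
        exact hrK.trans ⟨X.takeUntil v hv⟩⟩
    obtain ⟨yω, yθ, hyω, hyωR, hyθ, hyθR, hyr⟩ := exists_reps hI R₁ R₄ hyz hyz'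
    obtain ⟨y'ω, y'θ, hy'ω, hy'ωR, hy'θ, hy'θR, hy'r⟩ := exists_reps hI R₂ R₃ hy'z' hy'z
    obtain ⟨zω, zθ, hzω, hzωR, hzθ, hzθR, hzr⟩ := exists_reps hI R₁.reverse R₃.reverse (Ne.symm hyz) (Ne.symm hy'z)
    obtain ⟨z'ω, z'θ, hz'ω, hz'ωR, hz'θ, hz'θR, hz'r⟩ :=
      exists_reps hI R₂.reverse R₄.reverse (Ne.symm hy'z') (Ne.symm hyz')
    rw [SimpleGraph.Walk.support_reverse, List.mem_reverse] at hzωR hzθR hz'ωR hz'θR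
    exact false_of_quad hpos hI g1 g2 g3 c1 x0 x0' xC xC' xCC hr hL2 hKw hyK hy'K hzK hz'K hk hky hk' hky' hk₃ hk₃z hk₄ hk₄z'
      hyy' hzz' R₁ R₂ hR₁ hR₂ hd₁₂ R₃ R₄ hR₃ hR₄ hd₃₄ hyω hyωR hyθ hyθR hyr hy'ω hy'ωR hy'θ hy'θR hy'r hzω hzωR hzθ hzθR hzr
      hz'ω hz'ωR hz'θ hz'θR hz'r
  · -- CASE B: `K` consists of apices: the clash vertices are rim neighbours of `h`
    push Not at hrim
    have adjh : ∀ {k v : Fin n}, (openGraph ω).Reachable h k → H.Adj k v → v ∉ K → H.Adj h v ∧ ¬ hub v := by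
      intro k v hk hkv hvK
      have hkh : k = h := by
        obtain ⟨X⟩ := hk
        cases X with
        | nil => rfl
        | cons e X' =>
          rename_i u
          exact absurd (hrim u ⟨SimpleGraph.Walk.cons e SimpleGraph.Walk.nil⟩) (fun hu => hI h u hh hu (hadjH ω hω e))
      subst hkh
      exact ⟨hkv, fun hv => hI k v hh hv hkv⟩
    obtain ⟨hy, hyr⟩ := adjh hk hky hyK
    obtain ⟨hy', hy'r⟩ := adjh hk' hky' hy'K
    obtain ⟨hz, hzr⟩ := adjh hk₃ hk₃z hzK
    obtain ⟨hz', hz'r⟩ := adjh hk₄ hk₄z' hz'K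
    obtain ⟨x0, x0', xC, xC', xCC⟩ := hx y
    have hbh : b ≠ h := fun e => hab (e ▸ SimpleGraph.Reachable.refl b)
    have hch : c ≠ h := fun e => hac (e ▸ SimpleGraph.Reachable.refl c)
    -- representatives of the terminals
    obtain ⟨tb₁, tb₃, htb₁, htb₁R, htb₃, htb₃R, hb⟩ := exists_reps' hI (R₁.dropUntil b hbR₁) (R₃.dropUntil b hbR₃)
      (fun hb e => hzr (e ▸ hb)) (fun hb e => hzr (e ▸ hb))
    obtain ⟨tc₂, tc₄, htc₂, htc₂R, htc₄, htc₄R, hc⟩ := exists_reps' hI (R₂.dropUntil c hcR₂) (R₄.dropUntil c hcR₄)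
      (fun hc e => hz'r (e ▸ hc)) (fun hc e => hz'r (e ▸ hc))
    obtain ⟨t, t', ht, ht', htr, ht'r, hsep⟩ := sep_of_badRoot hpos hI g1 g2 g3 c1 x0 x0' xC xC' xCC hyr hh hy hz hy' hz'
      hzr hy'r hz'r hyz hyy' hyz' (Ne.symm hy'z) hzz' hy'z' hbh hch R₁ R₂ R₃ R₄
      (fun x hx e => hR₁ x hx (e ▸ hhK)) (fun x hx e => hR₂ x hx (e ▸ hhK)) (fun x hx e => hR₃ x hx (e ▸ hhK))
      (fun x hx e => hR₄ x hx (e ▸ hhK)) hd₁₂ hd₃₄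
      htb₁ (R₁.support_dropUntil_subset_support hbR₁ htb₁R) htb₃ (R₃.support_dropUntil_subset_support hbR₃ htb₃R) hb
      htc₂ (R₂.support_dropUntil_subset_support hcR₂ htc₂R) htc₄ (R₄.support_dropUntil_subset_support hcR₄ htc₄R) hc
    exact hS y y' t t' hy hy' htr ht'r ht ht' hsep

end Apices

/-! ### CSQ, DUU, TS at an apex root under the sector condition -/

section Fin

variable {n m : ℕ} (w : Sym2 (Fin n) → unitInterval) (h b c : Fin n) (H : SimpleGraph (Fin n)) (hub : Fin n → Prop)
  (pos : Fin n → Fin m)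

/-- **CSQ at an APEX root under the sector condition** (class (I)(R)(F)(L)(L2); `h` an apex, `b, c` arbitrary; `hS`: no chord of `h`
strictly separates a representative of `b` from one of `c`): `clusterSquare w h b c ≤ μ(b ↮ c)²`.
[cite: Gladkov2024, Thm. 4.3, Def. 4.2, Lemma 3.1, Ex. 2.5] -/
theorem clusterSquare_le_sq_of_apices_apex (hH : ∀ u v, u ≠ v → (0 : ℝ) < w s(u, v) → H.Adj u v)
    (hpos : ∀ u v, ¬ hub u → ¬ hub v → pos u = pos v → u = v) (hI : ∀ u v, hub u → hub v → ¬ H.Adj u v)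
    (hR : ∀ p q r s : Fin n, ¬ hub p → ¬ hub q → ¬ hub r → ¬ hub s → H.Adj p q → H.Adj r s →
      pos p < pos r → pos r < pos q → pos q < pos s → False)
    (hF : ∀ x p q u v : Fin n, hub x → ¬ hub p → ¬ hub q → H.Adj p q → H.Adj x u → H.Adj x v →
      pos p < pos u → pos u < pos q → (pos q < pos v ∨ pos v < pos p) → False)
    (hL : ∀ x x' u v u' v' : Fin n, hub x → hub x' → x ≠ x' → H.Adj x u → H.Adj x v → H.Adj x' u' → H.Adj x' v' →
      pos u < pos u' → pos u' < pos v → pos v < pos v' → False)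
    (hL2 : ∀ x x' u v t : Fin n, hub x → hub x' → x ≠ x' → u ≠ v → u ≠ t → v ≠ t →
      H.Adj x u → H.Adj x v → H.Adj x t → H.Adj x' u → H.Adj x' v → H.Adj x' t → False)
    (hh : hub h)
    (hS : ∀ α β t t' : Fin n, H.Adj h α → H.Adj h β → ¬ hub t → ¬ hub t' →
      ((¬ hub b ∧ t = b) ∨ (hub b ∧ H.Adj b t)) → ((¬ hub c ∧ t' = c) ∨ (hub c ∧ H.Adj c t')) →
      ¬ ((0 < (pos t - pos α).val ∧ (pos t - pos α).val < (pos β - pos α).val ∧ (pos β - pos α).val < (pos t' - pos α).val) ∨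
        (0 < (pos t' - pos α).val ∧ (pos t' - pos α).val < (pos β - pos α).val ∧
          (pos β - pos α).val < (pos t - pos α).val))) :
    clusterSquare w h b c ≤ (prodBernoulli w).real (openConn b c)ᶜ ^ 2 :=
  clusterSquare_le_sq_of_noQuadClash_pos w h b c (Apices.nqc_apexRoot H hub pos w hH hpos hI hR hF hL hL2 hh hS)

/-- **DUU at an APEX root under the sector condition**: `μ(h↮b, h↮c, b↮c)² ≤ μ(h↮b, h↮c) · μ(b↮c)²`.
[cite: Gladkov2024, Thm. 5.2 and Thm. 4.3] -/
theorem sq_real_split_le_of_apices_apex (hH : ∀ u v, u ≠ v → (0 : ℝ) < w s(u, v) → H.Adj u v)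
    (hpos : ∀ u v, ¬ hub u → ¬ hub v → pos u = pos v → u = v) (hI : ∀ u v, hub u → hub v → ¬ H.Adj u v)
    (hR : ∀ p q r s : Fin n, ¬ hub p → ¬ hub q → ¬ hub r → ¬ hub s → H.Adj p q → H.Adj r s →
      pos p < pos r → pos r < pos q → pos q < pos s → False)
    (hF : ∀ x p q u v : Fin n, hub x → ¬ hub p → ¬ hub q → H.Adj p q → H.Adj x u → H.Adj x v →
      pos p < pos u → pos u < pos q → (pos q < pos v ∨ pos v < pos p) → False)
    (hL : ∀ x x' u v u' v' : Fin n, hub x → hub x' → x ≠ x' → H.Adj x u → H.Adj x v → H.Adj x' u' → H.Adj x' v' →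
      pos u < pos u' → pos u' < pos v → pos v < pos v' → False)
    (hL2 : ∀ x x' u v t : Fin n, hub x → hub x' → x ≠ x' → u ≠ v → u ≠ t → v ≠ t →
      H.Adj x u → H.Adj x v → H.Adj x t → H.Adj x' u → H.Adj x' v → H.Adj x' t → False)
    (hh : hub h)
    (hS : ∀ α β t t' : Fin n, H.Adj h α → H.Adj h β → ¬ hub t → ¬ hub t' →
      ((¬ hub b ∧ t = b) ∨ (hub b ∧ H.Adj b t)) → ((¬ hub c ∧ t' = c) ∨ (hub c ∧ H.Adj c t')) →
      ¬ ((0 < (pos t - pos α).val ∧ (pos t - pos α).val < (pos β - pos α).val ∧ (pos β - pos α).val < (pos t' - pos α).val) ∨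
        (0 < (pos t' - pos α).val ∧ (pos t' - pos α).val < (pos β - pos α).val ∧
          (pos β - pos α).val < (pos t - pos α).val))) :
    (prodBernoulli w).real ((openConn h b)ᶜ ∩ (openConn h c)ᶜ ∩ (openConn b c)ᶜ) ^ 2 ≤
      (prodBernoulli w).real ((openConn h b)ᶜ ∩ (openConn h c)ᶜ) * (prodBernoulli w).real (openConn b c)ᶜ ^ 2 :=
  sq_real_split_le_of_noQuadClash_pos w h b c (Apices.nqc_apexRoot H hub pos w hH hpos hI hR hF hL hL2 hh hS)

/-- **TS rooted at an APEX under the sector condition**: `μ(h↮b, h↮c, b↮c)² ≤ μ(h↮b) · μ(h↮c) · μ(b↮c)`.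
[cite: Gladkov2024, Thm. 5.2, Cor. 5.3 (pattern) and Thm. 4.3] -/
theorem tripleSplit_of_apices_apex (hH : ∀ u v, u ≠ v → (0 : ℝ) < w s(u, v) → H.Adj u v)
    (hpos : ∀ u v, ¬ hub u → ¬ hub v → pos u = pos v → u = v) (hI : ∀ u v, hub u → hub v → ¬ H.Adj u v)
    (hR : ∀ p q r s : Fin n, ¬ hub p → ¬ hub q → ¬ hub r → ¬ hub s → H.Adj p q → H.Adj r s →
      pos p < pos r → pos r < pos q → pos q < pos s → False)
    (hF : ∀ x p q u v : Fin n, hub x → ¬ hub p → ¬ hub q → H.Adj p q → H.Adj x u → H.Adj x v →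
      pos p < pos u → pos u < pos q → (pos q < pos v ∨ pos v < pos p) → False)
    (hL : ∀ x x' u v u' v' : Fin n, hub x → hub x' → x ≠ x' → H.Adj x u → H.Adj x v → H.Adj x' u' → H.Adj x' v' →
      pos u < pos u' → pos u' < pos v → pos v < pos v' → False)
    (hL2 : ∀ x x' u v t : Fin n, hub x → hub x' → x ≠ x' → u ≠ v → u ≠ t → v ≠ t →
      H.Adj x u → H.Adj x v → H.Adj x t → H.Adj x' u → H.Adj x' v → H.Adj x' t → False)
    (hh : hub h)
    (hS : ∀ α β t t' : Fin n, H.Adj h α → H.Adj h β → ¬ hub t → ¬ hub t' →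
      ((¬ hub b ∧ t = b) ∨ (hub b ∧ H.Adj b t)) → ((¬ hub c ∧ t' = c) ∨ (hub c ∧ H.Adj c t')) →
      ¬ ((0 < (pos t - pos α).val ∧ (pos t - pos α).val < (pos β - pos α).val ∧ (pos β - pos α).val < (pos t' - pos α).val) ∨
        (0 < (pos t' - pos α).val ∧ (pos t' - pos α).val < (pos β - pos α).val ∧
          (pos β - pos α).val < (pos t - pos α).val))) :
    (prodBernoulli w).real ((openConn h b)ᶜ ∩ (openConn h c)ᶜ ∩ (openConn b c)ᶜ) ^ 2 ≤
      (prodBernoulli w).real (openConn h b)ᶜ * (prodBernoulli w).real (openConn h c)ᶜ *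
        (prodBernoulli w).real (openConn b c)ᶜ :=
  tripleSplit_of_noQuadClash_pos w h b c (Apices.nqc_apexRoot H hub pos w hH hpos hI hR hF hL hL2 hh hS)

end Fin

end Consts

end Summit.CriticalPhenomena.PercolationContinuityZ3.Theorems
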